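import Mathlib
import Literature.AlgebraicGeometry.Resolution.CobordantGame
import Literature.AlgebraicGeometry.Resolution.CobordantChartCoefficients
import Summits.ResolutionOfSingularities.ResolutionOfSingularities.Theorems.WeightedInvariantLocalWeightedDropTangentConeCut
import Summits.ResolutionOfSingularities.ResolutionOfSingularities.Theorems.WeightedInvariantLocalWeightedDropApexFreeOrderDrop

/-!
# `LocalWeightedDrop`: successors at TAME exceptional points are won with their slices

Route `ResolutionOfSingularities/WeightedInvariant`, crux `LocalWeightedDrop` (stmt-ResolutionOfSingularities-8899), line
`hasse-ridge-face-selection` (chain w43, [OURS · L1 W4.3]).  The slicing step used verbatim in B2, B3, B4 and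
`TangentConeCut.apexFreeStartsWon`, recorded ONCE as importable lemmas for the residual surface pieces S2/S3 (whose moves have
all weights in `{0, 1}`, so that EVERY exceptional point is tame and the game never leaves three variables):
at an exceptional point `c` with `c_i ≠ 0` and `p ∤ w_i`, the `s`-saturated successor is `G = u · Φ(cyl Sl)` over the slice
`Sl = G|_{y_i = 0}` (`tameSlice`), hence
* `order_slice_le` — `ord Sl ≤ ord G`;
* `won_successor_of_won_slice` — `Won Sl → Won G` (`won_cyl`, `won_subst_iff`, `won_unit_mul_iff`);
* `won_successor_of_slice_order_lt` — if `ord Sl < d` and every singular germ of order `< d` in the same number of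
  variables is won, then `G` is won (the slice is won by hypothesis if singular, outright if not);
* `won_successor_of_order_lt` — the same from `ord G < d`.
-/

set_option linter.dupNamespace false -- mandated namespace of this single-conjunct summit

namespace Summit.ResolutionOfSingularities.ResolutionOfSingularities.Theorems

open Literature.AlgebraicGeometry.Resolution

namespace TameSuccessor

variable {k : Type} [Field k]

/-- AT A TAME EXCEPTIONAL POINT THE SLICE HAS ORDER AT MOST THAT OF THE SUCCESSOR: `G = u · Φ(cyl Sl)` with `u` a unit and
`Φ`, `cyl` substitutions without constant terms, which do not lower the order. -/
theorem order_slice_le (p : ℕ) (hp : p.Prime) [CharP k p] {n : ℕ} (f : MvPowerSeries (Fin n) k)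
    (w : Fin n → ℕ) (c : Fin n → k) (hc : ∀ i, w i = 0 → c i = 0) (a : ℕ) (G : MvPowerSeries (Fin (n + 1)) k)
    (hfac : MvPowerSeries.subst (CobordantChart.chart w c) f = MvPowerSeries.X 0 ^ a * G)
    (i : Fin n) (hci : c i ≠ 0) (hpw : ¬ p ∣ w i) :
    (MvPowerSeries.subst (fun j : Fin (n + 1) => if j = i.succ then (0 : MvPowerSeries (Fin n) k)
      else MvPowerSeries.X (Fin.predAbove i j)) G).order ≤ G.order := by
  obtain ⟨Φ, u, hΦ0, -, -, hGu⟩ := tameSlice p hp k n f w c hc a G hfac i hci hpw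
  have h : (MvPowerSeries.subst (fun j : Fin (n + 1) => if j = i.succ then (0 : MvPowerSeries (Fin n) k)
      else MvPowerSeries.X (Fin.predAbove i j)) G).order ≤ (u * MvPowerSeries.subst Φ (MvPowerSeries.subst
        (fun m : Fin n => (MvPowerSeries.X ((Fin.succ i).succAbove m) : MvPowerSeries (Fin (n + 1)) k))
        (MvPowerSeries.subst (fun j : Fin (n + 1) => if j = i.succ then (0 : MvPowerSeries (Fin n) k)
          else MvPowerSeries.X (Fin.predAbove i j)) G))).order := by
    refine le_trans ?_ MvPowerSeries.le_order_mul
    refine le_trans ?_ le_add_self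
    refine le_trans ?_ (ApexFreeOrderDrop.order_le_order_subst hΦ0 _)
    exact ApexFreeOrderDrop.order_le_order_subst (fun m => MvPowerSeries.constantCoeff_X _) _
  rw [← hGu] at h
  exact h

/-- AT A TAME EXCEPTIONAL POINT THE SUCCESSOR IS WON WITH ITS SLICE: `Won Sl → Won G`. -/
theorem won_successor_of_won_slice (p : ℕ) (hp : p.Prime) [CharP k p] {n : ℕ} (f : MvPowerSeries (Fin n) k)
    (w : Fin n → ℕ) (c : Fin n → k) (hc : ∀ i, w i = 0 → c i = 0) (a : ℕ) (G : MvPowerSeries (Fin (n + 1)) k)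
    (hfac : MvPowerSeries.subst (CobordantChart.chart w c) f = MvPowerSeries.X 0 ^ a * G)
    (i : Fin n) (hci : c i ≠ 0) (hpw : ¬ p ∣ w i)
    (hwin : CobordantGame.Won k n (MvPowerSeries.subst (fun j : Fin (n + 1) => if j = i.succ then
      (0 : MvPowerSeries (Fin n) k) else MvPowerSeries.X (Fin.predAbove i j)) G)) :
    CobordantGame.Won k (n + 1) G := by
  obtain ⟨Φ, u, hΦ0, hΦdet, hu, hGu⟩ := tameSlice p hp k n f w c hc a G hfac i hci hpw
  rw [hGu]
  exact (won_unit_mul_iff hu _).mpr ((won_subst_iff hΦ0 hΦdet _).mpr (won_cyl i.succ hwin))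

/-- … IN PARTICULAR WHEN THE SLICE DROPS: if `ord Sl < d` and every singular germ of order `< d` in `n ≥ 1` variables is won,
then `G` is won. -/
theorem won_successor_of_slice_order_lt (p : ℕ) (hp : p.Prime) [CharP k p] {n : ℕ} (hn : 0 < n)
    (f : MvPowerSeries (Fin n) k) (w : Fin n → ℕ) (c : Fin n → k) (hc : ∀ i, w i = 0 → c i = 0) (a : ℕ)
    (G : MvPowerSeries (Fin (n + 1)) k)
    (hfac : MvPowerSeries.subst (CobordantChart.chart w c) f = MvPowerSeries.X 0 ^ a * G)
    (i : Fin n) (hci : c i ≠ 0) (hpw : ¬ p ∣ w i) {d : ℕ}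
    (hord : ∀ h : MvPowerSeries (Fin n) k, CobordantGame.IsSingular k h → h.order < (d : ℕ∞) →
      CobordantGame.Won k n h)
    (hlt : (MvPowerSeries.subst (fun j : Fin (n + 1) => if j = i.succ then (0 : MvPowerSeries (Fin n) k)
      else MvPowerSeries.X (Fin.predAbove i j)) G).order < (d : ℕ∞)) :
    CobordantGame.Won k (n + 1) G := by
  refine won_successor_of_won_slice p hp f w c hc a G hfac i hci hpw ?_
  by_cases hSs : CobordantGame.IsSingular k (MvPowerSeries.subst (fun j : Fin (n + 1) => if j = i.succ then
      (0 : MvPowerSeries (Fin n) k) else MvPowerSeries.X (Fin.predAbove i j)) G)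
  · exact hord _ hSs hlt
  · exact (wonBy_zero_of_not_isSingular hn hSs).won

/-- … OR WHEN THE SUCCESSOR ITSELF DROPS: if `ord G < d` (then `ord Sl ≤ ord G < d`). -/
theorem won_successor_of_order_lt (p : ℕ) (hp : p.Prime) [CharP k p] {n : ℕ} (hn : 0 < n)
    (f : MvPowerSeries (Fin n) k) (w : Fin n → ℕ) (c : Fin n → k) (hc : ∀ i, w i = 0 → c i = 0) (a : ℕ)
    (G : MvPowerSeries (Fin (n + 1)) k)
    (hfac : MvPowerSeries.subst (CobordantChart.chart w c) f = MvPowerSeries.X 0 ^ a * G)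
    (i : Fin n) (hci : c i ≠ 0) (hpw : ¬ p ∣ w i) {d : ℕ}
    (hord : ∀ h : MvPowerSeries (Fin n) k, CobordantGame.IsSingular k h → h.order < (d : ℕ∞) →
      CobordantGame.Won k n h)
    (hlt : G.order < (d : ℕ∞)) : CobordantGame.Won k (n + 1) G :=
  won_successor_of_slice_order_lt p hp hn f w c hc a G hfac i hci hpw hord
    (lt_of_le_of_lt (order_slice_le p hp f w c hc a G hfac i hci hpw) hlt)

/-- For moves with all weights in `{0, 1}` (point and curve blow-ups) every weight is prime to `p`, so EVERY exceptional point
is tame. -/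
theorem not_dvd_of_le_one {p : ℕ} (hp : p.Prime) {n : ℕ} {w : Fin n → ℕ} (hw : ∀ i, w i ≤ 1) {i : Fin n} (hi : 0 < w i) :
    ¬ p ∣ w i := by
  have h1 : w i = 1 := le_antisymm (hw i) hi
  rw [h1]
  exact fun h => hp.one_lt.ne' (Nat.dvd_one.mp h)

end TameSuccessor

end Summit.ResolutionOfSingularities.ResolutionOfSingularities.Theorems
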